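import Summits.CriticalPhenomena.Ising3DConformalLimit.Theorems.HyperoctahedralRPExistsScaleCovariantLimitCompactnessItemMaps
import Summits.CriticalPhenomena.Ising3DConformalLimit.Theorems.HyperoctahedralRPExistsScaleCovariantLimitPairMoveHoelderOfDoubling
import HarnessLib

/-!
# ITEM 5955 ⟺ ITEM 4658 ⟺ ITEM 6150 and crux ⟺ 6150 ∧ 6153, IMPORTABLE
(line `Sketch`, crux item stmt-CriticalPhenomena-1981 `ExistsScaleCovariantLimit`, route `HyperoctahedralRP`; registered anchor
`stub_compactnessItemMapsDoubling`; lead c5 (file prepared by lead c4), 2026-08-16)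

With F5 `stub_pairMoveHoelder_of_doubling` (p120021: item 6150 `TwoPointDoubling` ALONE gives the Hölder-`1/2` one-point-move modulus of the
pinned pair zoom) the compactness half of the 3D-Ising existence crux closes on ONE scalar lattice inequality:
* `pairEquicont_of_doubling` — 6150 ⟹ clause (b) of item 4658 AT ORDER TWO (two one-point moves based in `K`);
* `pairRegularity_of_doubling` — 6150 ⟹ PairRegularity (clauses (a), (c) from item 6157 `rescaledBounds_proof`);
* `orbitPrecompact_of_doubling`, `orbitPrecompact_iff_doubling` — **ITEM 5955 `OrbitPrecompact` ⟺ ITEM 6150 `TwoPointDoubling`**: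
  precompactness of the critical `ℤ³` Ising zoom orbit at ALL orders is EQUIVALENT to all-scale axis doubling `κ g(n) ≤ g(2n)` of the
  critical two-point function (`⟹` is the landed D p111525; ADC21 Remark 5.10: open, regular scales only in abundance);
* `uniformRegularity_iff_doubling` — **ITEM 4658 ⟺ ITEM 6150**; `crux_iff_doubling_and_pointwiseLimit` — **crux ⟺ 6150 ∧ 6153**;
* `stub_compactnessItemMapsDoubling` — the registered package.

References: M. Aizenman, H. Duminil-Copin, Ann. Math. 194 (2021), arXiv:1912.07973, Remark 5.10, Def. 5.11, Thm. 5.12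
[AizenmanDuminilCopinAnnals2021]; H. Duminil-Copin, ICM 2022 §8.4 [DuminilCopinICM2022]. No definitions, no `sorry`.
-/

noncomputable section

namespace Summit.CriticalPhenomena.Ising3DConformalLimit.Cruxes.ExistsScaleCovariantLimit.TwoHierarchies.ItemMaps

open Literature.Probability.LatticeModels Filter Set
open scoped Topology
open Summit.CriticalPhenomena.Ising3DConformalLimit.MoebiusLimitExistsOnlyInteraction (rhoPin)
open Summit.CriticalPhenomena.Ising3DConformalLimit.Cruxes.ExistsScaleCovariantLimit.TwoHierarchies
open Summit.CriticalPhenomena.Ising3DConformalLimit.Theses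

/-- **Clause (b) of item 4658 AT ORDER TWO from item 6150 alone**: uniform asymptotic equicontinuity of the pinned pair zoom on
compact sets of non-coincident pairs, by two one-point moves `(x₀,x₁) → (x₀,y₁) = (y with y₀ ↦ x₀) ← (y₀,y₁)` based in `K`, each
controlled by F5 `stub_pairMoveHoelder_of_doubling`. [cite: AizenmanDuminilCopinAnnals2021, arXiv:1912.07973 Remark 5.10 and Def. 5.11] -/
theorem pairEquicont_of_doubling (hD : MirrorHoelderCompactness.TwoPointDoubling) :
    ∀ K : Set (Fin 2 → EuclideanSpace ℝ (Fin 3)), K ⊆ NonCoincident 3 2 → IsCompact K →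
      ∀ ε : ℝ, 0 < ε → ∃ r δ₀ : ℝ, 0 < r ∧ 0 < δ₀ ∧ ∀ δ ∈ Set.Ioo 0 δ₀, ∀ x ∈ K, ∀ y ∈ K, dist x y < r →
        |rescaledCorrelator (criticalCorr 3) rhoPin 2 δ x - rescaledCorrelator (criticalCorr 3) rhoPin 2 δ y| < ε := by
  -- adapted from the skeleton `Lines/Sketch.lean` v13 (lead c4's F4 `stub_pairEquicont_of_separableHoelder`, p117936, with the
  -- Hölder modulus now coming from item 6150 alone)
  intro K hKs hK ε hε
  obtain ⟨C, δ₀, h₀, hδ₀, hh₀, hH⟩ := stub_pairMoveHoelder_of_doubling hD K hKs hK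
  set C' : ℝ := max C 1 with hC'
  have hC'pos : 0 < C' := lt_of_lt_of_le one_pos (le_max_right _ _)
  have hH' : ∀ δ ∈ Set.Ioo 0 δ₀, ∀ x ∈ K, ∀ (i : Fin 2) (y : EuclideanSpace ℝ (Fin 3)), ‖y - x i‖ ≤ h₀ →
      |rescaledCorrelator (criticalCorr 3) rhoPin 2 δ (Function.update x i y) -
        rescaledCorrelator (criticalCorr 3) rhoPin 2 δ x| ≤ C' * (‖y - x i‖ + δ) ^ (1 / 2 : ℝ) := by
    intro δ hδ x hx i y hy
    refine (hH δ hδ x hx i y hy).trans ?_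
    exact mul_le_mul_of_nonneg_right (le_max_left _ _) (Real.rpow_nonneg (add_nonneg (norm_nonneg _) hδ.1.le) _)
  set t : ℝ := (ε / (4 * C')) ^ 2 / 2 with ht
  have htpos : 0 < t := by positivity
  have hCt : C' * (2 * t) ^ (1 / 2 : ℝ) < ε / 2 := by
    have h2t : 2 * t = (ε / (4 * C')) ^ 2 := by rw [ht]; ring
    rw [h2t, ← Real.sqrt_eq_rpow, Real.sqrt_sq (by positivity)]
    have : C' * (ε / (4 * C')) = ε / 4 := by field_simp
    rw [this]
    linarith
  refine ⟨min t h₀, min t δ₀, lt_min htpos hh₀, lt_min htpos hδ₀, ?_⟩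
  intro δ hδ x hx y hy hxy
  have hδ' : δ ∈ Set.Ioo 0 δ₀ := ⟨hδ.1, lt_of_lt_of_le hδ.2 (min_le_right _ _)⟩
  have hδt : δ < t := lt_of_lt_of_le hδ.2 (min_le_left _ _)
  have hmove : ∀ i : Fin 2, ‖y i - x i‖ < min t h₀ := fun i => by
    have h1 : dist (y i) (x i) ≤ dist y x := dist_le_pi_dist y x i
    rw [dist_comm y x] at h1
    rw [← dist_eq_norm]
    exact lt_of_le_of_lt h1 hxy
  have hbound : ∀ (z : Fin 2 → EuclideanSpace ℝ (Fin 3)), z ∈ K → ∀ (i : Fin 2) (w : EuclideanSpace ℝ (Fin 3)),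
      ‖w - z i‖ < min t h₀ →
      |rescaledCorrelator (criticalCorr 3) rhoPin 2 δ (Function.update z i w) -
        rescaledCorrelator (criticalCorr 3) rhoPin 2 δ z| < ε / 2 := by
    intro z hz i w hw
    have hw₀ : ‖w - z i‖ ≤ h₀ := hw.le.trans (min_le_right _ _)
    have hwt : ‖w - z i‖ < t := lt_of_lt_of_le hw (min_le_left _ _)
    refine (hH' δ hδ' z hz i w hw₀).trans_lt (lt_of_le_of_lt ?_ hCt)
    refine mul_le_mul_of_nonneg_left (Real.rpow_le_rpow (add_nonneg (norm_nonneg _) hδ'.1.le) (by linarith)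
      (by norm_num)) hC'pos.le
  have hmid : Function.update x 1 (y 1) = Function.update y 0 (x 0) := by
    funext l
    refine Fin.cases ?_ (fun l' => ?_) l
    · simp
    · have : l' = 0 := Subsingleton.elim _ _
      subst this
      simp
  have h1 := hbound x hx 1 (y 1) (hmove 1)
  have h2 := hbound y hy 0 (x 0) (by rw [norm_sub_rev]; exact hmove 0)
  rw [← hmid] at h2
  have htri := abs_sub_le (rescaledCorrelator (criticalCorr 3) rhoPin 2 δ x)
    (rescaledCorrelator (criticalCorr 3) rhoPin 2 δ (Function.update x 1 (y 1)))
    (rescaledCorrelator (criticalCorr 3) rhoPin 2 δ y)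
  rw [abs_sub_comm] at h1
  linarith

/-- **Item 6150 ⟹ PairRegularity** (item 4658 at order two, with `ρ_pin`): clauses (a), (c) by `rescaledBounds_proof` (item 6157),
clause (b) by `pairEquicont_of_doubling`. [cite: AizenmanDuminilCopinAnnals2021, arXiv:1912.07973 Remark 5.10 and Def. 5.11] -/
theorem pairRegularity_of_doubling (hD : MirrorHoelderCompactness.TwoPointDoubling) :
    (∀ K : Set (Fin 2 → EuclideanSpace ℝ (Fin 3)), K ⊆ NonCoincident 3 2 → IsCompact K →
        ∃ M δ₀ : ℝ, 0 < δ₀ ∧ ∀ δ ∈ Set.Ioo 0 δ₀, ∀ x ∈ K,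
          |rescaledCorrelator (criticalCorr 3) rhoPin 2 δ x| ≤ M) ∧
      (∀ K : Set (Fin 2 → EuclideanSpace ℝ (Fin 3)), K ⊆ NonCoincident 3 2 → IsCompact K →
        ∀ ε : ℝ, 0 < ε → ∃ r δ₀ : ℝ, 0 < r ∧ 0 < δ₀ ∧ ∀ δ ∈ Set.Ioo 0 δ₀, ∀ x ∈ K, ∀ y ∈ K, dist x y < r →
          |rescaledCorrelator (criticalCorr 3) rhoPin 2 δ x - rescaledCorrelator (criticalCorr 3) rhoPin 2 δ y| < ε) ∧
      (∀ K : Set (Fin 2 → EuclideanSpace ℝ (Fin 3)), K ⊆ NonCoincident 3 2 → IsCompact K →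
        ∃ m δ₀ : ℝ, 0 < m ∧ 0 < δ₀ ∧ ∀ δ ∈ Set.Ioo 0 δ₀, ∀ x ∈ K,
          m ≤ rescaledCorrelator (criticalCorr 3) rhoPin 2 δ x) := by
  obtain ⟨ha, hc⟩ := MirrorHoelderCompactnessRescaledBounds.rescaledBounds_proof hD
  rw [rhoStar_eq_rhoPin] at ha hc
  exact ⟨fun K hKs hK => ha 2 K hKs hK, pairEquicont_of_doubling hD, hc⟩

/-- **Item 6150 ⟹ item 5955**: all-scale axis doubling of the critical two-point function ALONE gives precompactness of the critical
zoom orbit at all orders (`pairRegularity_of_doubling`, then `orbitPrecompact_of_pairRegularity`: crux 1344's reflection-positivity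
pedigree machinery re-run on pair regularity, F1–F3). [cite: DuminilCopinICM2022, §8.4 p. 29] -/
theorem orbitPrecompact_of_doubling (hD : MirrorHoelderCompactness.TwoPointDoubling) : MonotoneRG.OrbitPrecompact :=
  orbitPrecompact_of_pairRegularity (pairRegularity_of_doubling hD)

/-- **ITEM 5955 ⟺ ITEM 6150**: precompactness of the critical `ℤ³` Ising zoom orbit at ALL orders is EQUIVALENT to all-scale axis
doubling `κ g(n) ≤ g(2n)` of the critical two-point function — ONE scalar lattice inequality (`⟹` is the landed D p111525).
[cite: AizenmanDuminilCopinAnnals2021, arXiv:1912.07973 Remark 5.10 and Thm. 5.12] -/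
theorem orbitPrecompact_iff_doubling : MonotoneRG.OrbitPrecompact ↔ MirrorHoelderCompactness.TwoPointDoubling :=
  ⟨stub_twoPointDoubling_of_orbitPrecompact, orbitPrecompact_of_doubling⟩

/-- **ITEM 4658 ⟺ ITEM 6150** (`orbitPrecompact_iff_uniformRegularity` with `orbitPrecompact_iff_doubling`).
[cite: AizenmanDuminilCopinAnnals2021, arXiv:1912.07973 Remark 5.10 and Thm. 5.12] -/
theorem uniformRegularity_iff_doubling : MonotoneRG.UniformRegularity ↔ MirrorHoelderCompactness.TwoPointDoubling := by
  rw [← orbitPrecompact_iff_uniformRegularity, orbitPrecompact_iff_doubling]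

/-- **Item 6150 ⟹ item 4658** (the `⟸` direction of `uniformRegularity_iff_doubling`, for importers that want the implication).
[cite: AizenmanDuminilCopinAnnals2021, arXiv:1912.07973 Remark 5.10] -/
theorem uniformRegularity_of_doubling (hD : MirrorHoelderCompactness.TwoPointDoubling) : MonotoneRG.UniformRegularity :=
  uniformRegularity_iff_doubling.2 hD

/-- **crux ⟺ item 6150 ∧ item 6153**: existence of the scale-covariant continuum limit of the critical `ℤ³` Ising correlators =
all-scale axis doubling of the two-point function + full-filter pointwise convergence of the pinned zoom (IM p116283 with
`orbitPrecompact_iff_doubling`). [cite: DuminilCopinICM2022, §8.4 p. 29] -/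
theorem crux_iff_doubling_and_pointwiseLimit :
    HyperoctahedralRP.ExistsScaleCovariantLimit ↔
      (MirrorHoelderCompactness.TwoPointDoubling ∧ MirrorHoelderCompactness.PointwiseLimit) := by
  rw [stub_cruxIffOrbitPrecompactPointwiseLimit, orbitPrecompact_iff_doubling]

/-- **Registered anchor `stub_compactnessItemMapsDoubling`** — the package 5955 ⟺ 6150, 4658 ⟺ 6150, crux ⟺ 6150 ∧ 6153.
[cite: DuminilCopinICM2022, §8.4 p. 29] -/
theorem stub_compactnessItemMapsDoubling :
    (MonotoneRG.OrbitPrecompact ↔ MirrorHoelderCompactness.TwoPointDoubling) ∧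
    (MonotoneRG.UniformRegularity ↔ MirrorHoelderCompactness.TwoPointDoubling) ∧
    (HyperoctahedralRP.ExistsScaleCovariantLimit ↔
      (MirrorHoelderCompactness.TwoPointDoubling ∧ MirrorHoelderCompactness.PointwiseLimit)) :=
  ⟨orbitPrecompact_iff_doubling, uniformRegularity_iff_doubling, crux_iff_doubling_and_pointwiseLimit⟩

end Summit.CriticalPhenomena.Ising3DConformalLimit.Cruxes.ExistsScaleCovariantLimit.TwoHierarchies.ItemMaps

end
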